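import Literature.Geometry.Riemannian.MeanConvexSurroundingHandles
import Literature.Geometry.Riemannian.MeanConvexSurroundingEndgame
import Literature.Geometry.Riemannian.MeanConvexSurroundingOuterBand
import Literature.Topology.FourManifolds.EuclideanRegularDomainExtension
import Literature.Topology.FourManifolds.EuclideanRegularDomainCritical

/-!
# Lawson–Michelsohn (1984), Thm. 6.1 reduced to the mean-convex core of the handlebody

Topic `Geometry/Riemannian` (fact seat
`provefact-Literature.Geometry.Riemannian.LawsonMichelsohn1984_surrounding`).  Everything here
is **proved**; no named fact is introduced.

This file assembles everything in the proof of Thm. 6.1 that is not the geometric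
handle-by-handle surrounding construction (Thm. 3.1 and its iteration over the handles):

* the handle decomposition of the `1`-thin domain `D = {F ≤ 0}` without handles of index `≥ m`,
  as a Morse function `f` on the cobordism `(D; ∅, N)` without critical points of index `m + 1`
  and `m` (`exists_isMorseFunction_domain`, Milnor 1965 Thm. 8.1 and Wall's trading theorem);
* the Seeley extension `f̂` of `f` to `ℝ^{m+1}` (`IsRegularCompactDomain.exists_contDiff_forall_eq`)
  and the transfer of critical points (`IsRegularCompactDomain.isMCriticalPt_comp_incl_iff`);
* the clock `g = ((f̂ - a)/(1 - a)) ∘ H⁻¹` of the product region above the core, its compact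
  regular band (`exists_compactBand_clock`), and the endgame — the gradient collar of the clock
  is the strong isotopy (`LawsonMichelsohn1984_surrounding_of_coreLevelFunctions`).

What remains as the hypothesis `hcores` of
`LawsonMichelsohn1984_surrounding_of_meanConvexCores` is exactly the geometric content of
Thms. 3.1/6.1: **given the Morse function `f` (indices `≤ m - 1`) on `(D; ∅, N)`, a level `a < 1`
above all critical values, an ambient diffeomorphism `H` of `ℝ^{m+1}` equal to the identity where
`F > -η` (near `∂D` and outside `D`), and a smooth defining function `F'` of a compact domain
with `{F' = 0} = H(f⁻¹(a))`, regular and strictly mean convex along its boundary** — i.e. the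
sublevel handlebody `f⁻¹[0, a] ≅ D` is carried by an ambient diffeomorphism onto a mean-convex
domain.

## References

* H. B. Lawson, Jr., M.-L. Michelsohn, *Embedding and surrounding with positive mean curvature*,
  Invent. Math. 77 (1984), Thms. 3.1, 6.1. [LawsonMichelsohn1984]
* J. Milnor, *Lectures on the h-cobordism theorem* (1965), Thm. 8.1. [MilnorHCobordism1965]
-/

noncomputable section

open scoped Manifold ContDiff
open Set Function Literature.Topology.FourManifolds

namespace Literature.Geometry.Riemannian

/-- A bijection that fixes a set pointwise maps its complement into itself. [folklore] -/
theorem apply_notMem_of_forall_eq {α : Type*} {H : α → α} (hH : Injective H) {S : Set α}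
    (hS : ∀ x ∈ S, H x = x) {x : α} (hx : x ∉ S) : H x ∉ S := fun h =>
  hx (by rwa [← hH (hS (H x) h)])

/-- Above all the (finitely many) critical values of a Morse function lying below `a`, there is a
level `a₀ < a` still above all of them. [folklore] -/
theorem exists_lt_forall_le_of_finite {ι : Type*} {f : ι → ℝ} {S : Set ι} (hS : S.Finite) {a : ℝ}
    (h : ∀ p ∈ S, f p < a) : ∃ a₀ : ℝ, a₀ < a ∧ ∀ p ∈ S, f p ≤ a₀ := by
  classical
  rcases (hS.toFinset.image f).eq_empty_or_nonempty with hT | hT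
  · refine ⟨a - 1, by linarith, fun p hp => ?_⟩
    have : f p ∈ hS.toFinset.image f := Finset.mem_image_of_mem f (hS.mem_toFinset.2 hp)
    rw [hT] at this
    exact absurd this (Finset.notMem_empty _)
  · refine ⟨(hS.toFinset.image f).max' hT, ?_, fun p hp =>
      Finset.le_max' _ _ (Finset.mem_image_of_mem f (hS.mem_toFinset.2 hp))⟩
    obtain ⟨p, hp, hpeq⟩ := Finset.mem_image.1 ((hS.toFinset.image f).max'_mem hT)
    rw [← hpeq]
    exact h p (hS.mem_toFinset.1 hp)

/-- **Lawson–Michelsohn's Thm. 6.1, reduced to the mean-convex core of the handlebody.**  Suppose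
that for every datum of `LawsonMichelsohn1984_surrounding` and every Morse function `f` on the
cobordism `(D; ∅, N)`, `D = {F ≤ 0}`, without critical points of index `m + 1` and `m`, there are:
a level `a < 1` above all critical values of `f`, `η > 0`, a diffeomorphism `H` of `ℝ^{m+1}`
with `H = id` on `{F > -η}`, and a `C^∞` function `F'` with `{F' ≤ 0}` compact, `dF' ≠ 0` on
`{F' = 0} = H(f⁻¹(a))`, satisfying the mean-convexity clause of the fact along `{F' = 0}` (the
surrounding of the handlebody `f⁻¹[0, a]` by a mean-convex domain, Thm. 3.1 iterated).  Then
`LawsonMichelsohn1984_surrounding` holds. [cite: LawsonMichelsohn1984, Thms. 3.1, 6.1] -/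
theorem LawsonMichelsohn1984_surrounding_of_meanConvexCores
    (hcores : ∀ (m : ℕ) (hm : 4 ≤ m) (N : Type) [TopologicalSpace N] [T2Space N]
      [SecondCountableTopology N] [CompactSpace N] [ConnectedSpace N]
      [ChartedSpace (EuclideanSpace ℝ (Fin m)) N] [IsManifold (𝓡 m) ∞ N]
      (F : EuclideanSpace ℝ (Fin (m + 1)) → ℝ) (e : N → EuclideanSpace ℝ (Fin (m + 1)))
      (h : IsRegularCompactDomain F)
      (he : Manifold.IsSmoothEmbedding (𝓡 m) 𝓘(ℝ, EuclideanSpace ℝ (Fin (m + 1))) ∞ e)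
      (hrange : range e = {x | F x = 0})
      (f : (h.cobordismOfEmbedding (by omega) he hrange).W → ℝ),
      RelPiOneTrivial {x : EuclideanSpace ℝ (Fin (m + 1)) // F x ≤ 0} {p | F p.1 = 0} →
      (h.cobordismOfEmbedding (by omega) he hrange).IsMorseFunction f →
      criticalSetOfIndex (𝓡∂ (m + 1)) f (m + 1) = ∅ → criticalSetOfIndex (𝓡∂ (m + 1)) f m = ∅ →
      ∃ (a η : ℝ) (H : EuclideanSpace ℝ (Fin (m + 1)) ≃ₘ⟮𝓘(ℝ, EuclideanSpace ℝ (Fin (m + 1))),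
          𝓘(ℝ, EuclideanSpace ℝ (Fin (m + 1)))⟯ EuclideanSpace ℝ (Fin (m + 1)))
        (F' : EuclideanSpace ℝ (Fin (m + 1)) → ℝ),
        (∀ p, IsMCriticalPt (𝓡∂ (m + 1)) f p → f p < a) ∧ a < 1 ∧ 0 < η ∧
        (∀ x, -η < F x → H x = x) ∧ ContDiff ℝ ∞ F' ∧ IsCompact {x | F' x ≤ 0} ∧
        (∀ x, F' x = 0 → fderiv ℝ F' x ≠ 0) ∧
        {x | F' x = 0} = H '' (IsRegularCompactDomain.Domain.incl h '' (f ⁻¹' {a})) ∧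
        ∀ x, F' x = 0 → ∀ v : Fin m → EuclideanSpace ℝ (Fin (m + 1)), Orthonormal ℝ v →
          (∀ i, fderiv ℝ F' x (v i) = 0) → 0 < ∑ i, iteratedFDeriv ℝ 2 F' x ![v i, v i]) :
    LawsonMichelsohn1984_surrounding := by
  refine LawsonMichelsohn1984_surrounding_of_coreLevelFunctions ?_
  intro m hm N _ _ _ _ _ _ _ F e hF hD hreg he hrange h1
  have hm1 : 1 ≤ m := by omega
  -- the handle decomposition: a Morse function without critical points of index `m + 1`, `m`
  obtain ⟨h, f, hf, htop, hmid⟩ := exists_isMorseFunction_domain hm N F e hF hD hreg he hrange h1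
  -- the geometric core
  obtain ⟨a, η, H, F', hcrit, ha1, hη, hHid, hF', hF'c, hF'reg, hF'zero, hF'conv⟩ :=
    hcores m hm N F e h he hrange f h1 hf htop hmid
  -- `H` and `H⁻¹` as smooth maps of the vector space; `H⁻¹ = id` on `{F > -η}`
  have hHc : ContDiff ℝ ∞ (H : EuclideanSpace ℝ (Fin (m + 1)) → EuclideanSpace ℝ (Fin (m + 1))) :=
    contMDiff_iff_contDiff.1 H.contMDiff
  have hHsc : ContDiff ℝ ∞
      (H.symm : EuclideanSpace ℝ (Fin (m + 1)) → EuclideanSpace ℝ (Fin (m + 1))) :=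
    contMDiff_iff_contDiff.1 H.symm.contMDiff
  have hHsid : ∀ x, -η < F x → H.symm x = x := fun x hx => by
    conv_lhs => rw [← hHid x hx]
    exact H.symm_apply_apply x
  have hHdeep : ∀ x, F x ≤ -η → F (H x) ≤ -η := fun x hx => by
    by_contra h'
    exact apply_notMem_of_forall_eq H.injective (S := {x | -η < F x}) hHid
      (show ¬ (-η < F x) from not_lt.2 hx) (not_le.1 h')
  have hHsdeep : ∀ x, F x ≤ -η → F (H.symm x) ≤ -η := fun x hx => by
    by_contra h'
    have := hHid (H.symm x) (not_le.1 h')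
    rw [H.apply_symm_apply] at this
    rw [← this] at h'
    exact h' hx
  have hHsD : ∀ x, F x ≤ 0 → F (H.symm x) ≤ 0 := fun x hx => by
    rcases lt_or_ge (-η) (F x) with h' | h'
    · rw [hHsid x h']; exact hx
    · exact (hHsdeep x h').trans (by linarith)
  have hHsneg : ∀ x, F x < 0 → F (H.symm x) < 0 := fun x hx => by
    rcases lt_or_ge (-η) (F x) with h' | h'
    · rw [hHsid x h']; exact hx
    · exact (hHsdeep x h').trans_lt (by linarith)
  -- the Seeley extension of `f`
  have hfs : ContMDiff (𝓡∂ (m + 1)) 𝓘(ℝ, ℝ) ∞ f := hf.isMorse.contMDiff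
  obtain ⟨fe, hfe, hfef⟩ := h.exists_contDiff_forall_eq hfs
  have hfeq : f = fe ∘ IsRegularCompactDomain.Domain.incl h := funext fun p => (hfef p).symm
  -- values of `f`: `1` on `{F = 0}`, `< 1` on `{F < 0}`
  have hfe1 : ∀ x, F x = 0 → fe x = 1 := by
    intro x hx
    obtain ⟨p, hp⟩ := (IsRegularCompactDomain.Domain.range_incl_comp_val_boundary h).symm.subset hx
    have hpb : p.1 ∈ range (h.cobordismOfEmbedding (by omega) he hrange).inr := by
      rw [h.range_cobordismOfEmbedding_inr (by omega) he hrange]; exact p.2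
    obtain ⟨y, hy⟩ := hpb
    rw [← hp, hfef, ← hy]
    exact hf.2.2.1 y
  have hfelt : ∀ x, F x < 0 → fe x < 1 := by
    intro x hx
    have hint := (IsRegularCompactDomain.Domain.isInteriorPoint_iff h
      (IsRegularCompactDomain.Domain.mk h x hx.le)).2 hx
    have := hf.2.2.2.2 _ hint
    rw [hfeq] at this
    exact this.2
  -- critical points of `f` versus `dfe`
  have hcritiff : ∀ p : h.Domain, IsMCriticalPt (𝓡∂ (m + 1)) f p ↔
      fderiv ℝ fe (IsRegularCompactDomain.Domain.incl h p) = 0 := fun p => by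
    rw [hfeq]; exact h.isMCriticalPt_comp_incl_iff hm1 hfe p
  -- a level `a₀ < a` above all critical values
  obtain ⟨a₀, ha₀a, ha₀⟩ := exists_lt_forall_le_of_finite (f := f)
    (IsMorse.finite_criticalSet_holds hf.isMorse) (a := a) fun p hp => hcrit p hp
  have h1a : 0 < 1 - a := by linarith
  set lo' : ℝ := (a₀ - a) / (2 * (1 - a)) with hlo'
  have hlo'neg : lo' < 0 := div_neg_of_neg_of_pos (by linarith) (by positivity)
  -- the clock
  set g₀ : EuclideanSpace ℝ (Fin (m + 1)) → ℝ := fun x => (fe x - a) / (1 - a) with hg₀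
  have hg₀c : ContDiff ℝ ∞ g₀ := (hfe.sub contDiff_const).div_const _
  set g : EuclideanSpace ℝ (Fin (m + 1)) → ℝ := g₀ ∘ H.symm with hg
  have hgc : ContDiff ℝ ∞ g := hg₀c.comp hHsc
  have hopen : IsOpen {x : EuclideanSpace ℝ (Fin (m + 1)) | -η < F x} :=
    isOpen_lt continuous_const hF.continuous
  have hgev : ∀ x, -η < F x → g =ᶠ[nhds x] g₀ := fun x hx =>
    (hopen.eventually_mem hx).mono fun y hy => by
      show g₀ (H.symm y) = g₀ y; rw [hHsid y hy]
  have hg1 : ∀ x, F x = 0 → g x = 1 := fun x hx => by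
    show g₀ (H.symm x) = 1
    rw [hHsid x (by rw [hx]; linarith), hg₀]
    dsimp only
    rw [hfe1 x hx, div_self h1a.ne']
  have hglt : ∀ x, F x < 0 → g x < 1 := fun x hx => by
    show (fe (H.symm x) - a) / (1 - a) < 1
    rw [div_lt_one h1a]
    linarith [hfelt _ (hHsneg x hx)]
  have hgreg : ∀ x, F x = 0 → fderiv ℝ g x ≠ 0 := by
    intro x hx hzero
    rw [(hgev x (by rw [hx]; linarith)).fderiv_eq] at hzero
    have hfd : fderiv ℝ g₀ x = (1 - a)⁻¹ • fderiv ℝ fe x := by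
      show fderiv ℝ (fun x => (fe x - a) / (1 - a)) x = _
      rw [show (fun x => (fe x - a) / (1 - a)) = fun x => (1 - a)⁻¹ * (fe x - a) from
        funext fun x => by rw [div_eq_inv_mul]]
      rw [fderiv_const_mul ((hfe.differentiable (by simp) x).sub_const a),
        fderiv_sub_const]
    rw [hfd, smul_eq_zero, inv_eq_zero] at hzero
    rcases hzero with h0 | h0
    · exact h1a.ne' h0
    · -- `x = incl p` with `p` a boundary point, not critical
      set p := IsRegularCompactDomain.Domain.mk h x hx.le
      have hpb : p ∈ (𝓡∂ (m + 1)).boundary h.Domain :=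
        (IsRegularCompactDomain.Domain.mem_boundary_iff h p).2 hx
      exact hf.2.2.2.1 p hpb ((hcritiff p).2 h0)
  have hin : ∀ x, F x ≤ 0 → lo' ≤ g x → fderiv ℝ g x ≠ 0 := by
    intro x hx hlo hzero
    set y := H.symm x with hy
    have hyD : F y ≤ 0 := hHsD x hx
    have hHy : H y = x := H.apply_symm_apply x
    -- `dg₀(y) = dg(x) ∘ dH(y) = 0`
    have hg₀g : g₀ = g ∘ H := funext fun z => by
      show g₀ z = g₀ (H.symm (H z)); rw [H.symm_apply_apply]
    have hd0 : fderiv ℝ g₀ y = 0 := by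
      rw [hg₀g, fderiv_comp y (by rw [hHy]; exact hgc.differentiable (by simp) x)
        (hHc.differentiable (by simp) y), hHy, hzero, ContinuousLinearMap.zero_comp]
    have hfd : fderiv ℝ fe y = (1 - a) • fderiv ℝ g₀ y := by
      have : fe = fun z => (1 - a) * g₀ z + a := funext fun z => by
        show fe z = (1 - a) * ((fe z - a) / (1 - a)) + a
        field_simp; ring
      rw [this, fderiv_add_const, fderiv_const_mul (hg₀c.differentiable (by simp) y)]
    rw [hd0, smul_zero] at hfd
    -- so `y = incl p` with `p` critical, `f p ≤ a₀`, contradicting `lo' ≤ g x`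
    set p := IsRegularCompactDomain.Domain.mk h y hyD
    have hpc : IsMCriticalPt (𝓡∂ (m + 1)) f p := (hcritiff p).2 hfd
    have hfp : f p ≤ a₀ := ha₀ p hpc
    have hgx : g x = (f p - a) / (1 - a) := by
      show (fe (H.symm x) - a) / (1 - a) = _
      rw [hfeq]; rfl
    rw [hgx] at hlo
    have hlo2 : lo' * (1 - a) ≤ f p - a := (le_div_iff₀ h1a).1 hlo
    have hlo3 : lo' * (1 - a) = (a₀ - a) / 2 := by rw [hlo']; field_simp
    rw [hlo3] at hlo2
    linarith
  -- the compact regular band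
  obtain ⟨ĝ, hi', hĝ, hhi', ⟨U, hUo, hDU, hĝU⟩, hbandc, hbandreg, hle1, heq1⟩ :=
    exists_compactBand_clock hF hD hreg hgc hg1 hglt hgreg hin
  refine ⟨ĝ, F', lo', hi', hĝ, hlo'neg, hhi', hbandc, hbandreg, ?_, hF', hF'c, hF'reg, ?_,
    hF'conv⟩
  · -- `range e = {ĝ = 1}`
    rw [hrange]
    ext x
    exact (heq1 x).symm
  · -- `{F' = 0} = {ĝ = 0}`
    rw [hF'zero]
    ext x
    constructor
    · rintro ⟨z, ⟨p, hp, rfl⟩, rfl⟩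
      have hpa : f p = a := hp
      have hzD : F (IsRegularCompactDomain.Domain.incl h p) ≤ 0 := p.2
      have hxD : F (H (IsRegularCompactDomain.Domain.incl h p)) ≤ 0 := by
        rcases lt_or_ge (-η) (F (IsRegularCompactDomain.Domain.incl h p)) with h' | h'
        · rw [hHid _ h']; exact hzD
        · exact (hHdeep _ h').trans (by linarith)
      show ĝ _ = 0
      rw [hĝU _ (hDU hxD)]
      show g₀ (H.symm (H _)) = 0
      rw [H.symm_apply_apply, hg₀]
      dsimp only
      rw [hfef, hpa, sub_self, zero_div]
    · intro hx
      have hx0 : ĝ x = 0 := hx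
      have hxD : F x ≤ 0 := hle1 x (by rw [hx0]; exact zero_le_one)
      rw [hĝU x (hDU hxD)] at hx0
      set y := H.symm x with hy
      have hyD : F y ≤ 0 := hHsD x hxD
      have hfy : fe y = a := by
        have : (fe y - a) / (1 - a) = 0 := hx0
        rw [div_eq_zero_iff] at this
        rcases this with h0 | h0
        · linarith
        · exact absurd h0 h1a.ne'
      refine ⟨y, ⟨IsRegularCompactDomain.Domain.mk h y hyD, ?_, rfl⟩, H.apply_symm_apply x⟩
      show f _ = a
      rw [hfeq]; exact hfy

end Literature.Geometry.Riemannian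

end
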